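import Mathlib
import Literature.NumberTheory.DiophantineApproximation.KoksmaInequality
import HarnessLib

/-!
# The Koksma–Hlawka inequality in dimension `s` (Hlawka 1961; Hlawka–Zaremba identity)

Topic `Literature/NumberTheory/DiophantineApproximation`; PROVED theorems (no named fact).
Companion of `KoksmaInequality` (`Discrepancy.koksma`, dimension one, `C¹` form),
`KoksmaInequalityBV` (dimension one, bounded variation) and `KoksmaHlawkaInequality2D`
(`s = 2`).  This file proves the general-dimension statement, over all `2^s − 1` non-empty
faces, for integrands with continuous mixed partial derivatives — the form in which the
inequality is stated and proved in [cite: DickPillichshammer2010, Prop. 2.18] via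
**Hlawka's identity** (also called **Zaremba's identity**) [cite: DickPillichshammer2010, Prop. 2.17]
(book pp. 33–34):

*Proposition 2.17 (Hlawka's identity).* `Q_N(f) − I(f) = Σ_{∅ ≠ u ⊆ I_s} (−1)^{|u|}
∫_{[0,1]^{|u|}} (∂^{|u|} f/∂x_u)(x_u, 1) Δ_P(x_u, 1) dx_u`, where `I_s = {1,…,s}`,
`Q_N(f) = (1/N) Σ_n f(x_n)`, `I(f) = ∫_{[0,1]^s} f`, `(x_u, 1)` is the point whose `i`-th coordinate
is `x_i` for `i ∈ u` and `1` otherwise, and `Δ_P(x) = #{n : x_n ∈ [0, x)}/N − x_1 ⋯ x_s` is the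
local discrepancy of the point set `P = {x_0,…,x_{N−1}} ⊆ [0,1)^s` ("Note that
`Δ_P(x_∅, 1) = Δ_P(1) = 0`", loc. cit., which is why `u = ∅` is absent).

*Proposition 2.18 (Koksma–Hlawka inequality).* For `f : [0,1]^s → ℝ` all of whose mixed partial
derivatives are continuous on `[0,1]^s`,
`|I(f) − Q_N(f)| ≤ D*_N(P) · ‖f‖_{s,1}`, `‖f‖_{s,1} = Σ_{u ⊆ I_s} ∫_{[0,1]^{|u|}} |(∂^{|u|} f/∂x_u)(x_u, 1)| dx_u`,
`D*_N(P) = sup_{x ∈ [0,1]^s} |Δ_P(x)|` the star discrepancy; by Remark 2.19 (loc. cit.) the sum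
over the NON-EMPTY `u` alone is the variation of `f` in the sense of Hardy and Krause, and the
inequality holds with it (the `u = ∅` summand `|f(1)|` is not needed) — that is Hlawka's theorem
[cite: Niederreiter1992, Thm 2.11] (`|(1/N) Σ_n f(x_n) − ∫ f| ≤ V(f) D*_N`, his eq. (2.5) for
`V^{(s)}` of smooth `f`), also [cite: KuipersNiederreiter1974, Ch. 2 Thm 5.5].

## What is formalised (any dimension `s`)

Points `x_n ∈ [0,1)^s` (`x : Fin N → Fin s → ℝ`, `0 ≤ x n i < 1`), `N ≥ 1`; the counting function
`boxCount x z = #{n : ∀ i, x n i < z i}` of the anchored half-open box `∏_i [0, z_i)`, the local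
discrepancy `boxDelta x z = boxCount/N − ∏_i z_i` (`Δ_P`), the star discrepancy
`starDiscrepancy x = sup_{[0,1]^s} |Δ_P|` with `0 ≤ D*_N ≤ 1` (`starDiscrepancy_nonneg`,
`starDiscrepancy_le_one`, `abs_boxDelta_le_starDiscrepancy`), and the face map
`projOne u z = (z_u, 1)`.  The integrand is given together with ALL its mixed partial derivatives
as a family `F : Finset (Fin s) → (ℝ^s → ℝ)`, `F ∅ = f`, `F u = ∂^{|u|} f/∂x_u`, through the
hypotheses `∀ u, ContinuousOn (F u) [0,1]^s` and, for `i ∉ u` and `z ∈ [0,1]^s`,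
`HasDerivAt (t ↦ F u (z[i ↦ t])) (F (u ∪ {i}) z) (z i)` — exactly the data
`(∂^{|u|}f/∂x_u)(x_u, 1)` entering Propositions 2.17/2.18 (by the symmetry of continuous mixed
partials the order of differentiation is immaterial, which is what makes such a family exist for
a `C^{(1,…,1)}` function; the file takes the family as data and proves everything from it).

* `hlawka_zaremba_identity` (Prop. 2.17):
  `(1/N) Σ_n f(x_n) − ∫_{[0,1]^s} f
     = Σ_{u ≠ ∅} (−1)^{|u|} ∫_{[0,1]^s} Δ_P(z_u,1) (∂^{|u|}f/∂x_u)(z_u,1) dz`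
  (the integrand depends on `z_u` only, so the integral over the cube equals the book's
  integral over `[0,1]^{|u|}`).
* `koksma_hlawka` (Prop. 2.18 / Niederreiter Thm 2.11): if `|Δ_P(z)| ≤ D` on `[0,1]^s` then
  `|(1/N) Σ_n f(x_n) − ∫ f| ≤ D · Σ_{u ≠ ∅} ∫_{[0,1]^s} |(∂^{|u|}f/∂x_u)(z_u,1)| dz`,
  the sum being `V_HK(f)` for such `f` (Remark 2.19).
* `koksma_hlawka_starDiscrepancy`: the same with `D = starDiscrepancy x` (`D*_N`), the literal
  shape of Theorem 2.11; `koksma_hlawka_norm_one`: the literal shape of Prop. 2.18 (sum over all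
  `u`, i.e. with the extra harmless summand `|f(1)|`).

Proof (loc. cit., the elementary route of Hlawka and Zaremba rather than the reproducing-kernel
route of the book): ONE expansion lemma, proved by induction over the set `w` of coordinates
already treated — for kernels `κ_i : [0,1] → [0,1]` and weights `φ_i` with
`∫₀¹ g(κ_i t) dt = g(1) − ∫₀¹ φ_i(t) g′(t) dt` for every `C¹` `g`,
`∫_{[0,1]^s} f(κ(z)) dz = Σ_{u} (−1)^{|u|} ∫_{[0,1]^s} (∏_{i∈u} φ_i(z_i)) (∂^{|u|}f/∂x_u)(z_u,1) dz`;
the induction step integrates out one coordinate (Fubini on `[0,1]^s ≅ [0,1] × [0,1]^{s−1}` at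
that coordinate, `MeasureTheory.measurePreserving_piFinSuccAbove`) and applies the
one-dimensional rule there.  With `κ_i ≡ y_i`, `φ_i = 1[y_i < ·]` (fundamental theorem of
calculus on `[y_i, 1]`) this is the expansion of `f(y)` for one point `y ∈ [0,1)^s`; with
`κ_i = id`, `φ_i = id` (integration by parts) it is the expansion of `∫ f`; averaging the first
over the points and subtracting the second gives the identity, since
`(1/N) Σ_n ∏_{i∈u} 1[x_{n,i} < z_i] − ∏_{i∈u} z_i = Δ_P(z_u, 1)` for points of `[0,1)^s`
(`boxDelta_projOne`), and `|Δ_P| ≤ D` gives the inequality.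

Not formalised here: the Hardy–Krause bounded-variation generality of Hlawka's theorem (no
derivatives; Vitali variations over all faces), and the reproducing-kernel proof of the book.

## References

* J. Dick, F. Pillichshammer, *Digital Nets and Sequences*, Cambridge Univ. Press 2010, §2.4
  pp. 33–34: Proposition 2.17 (Hlawka's identity / Zaremba's identity), Proposition 2.18
  (Koksma–Hlawka inequality), Remark 2.19. [cite: DickPillichshammer2010, Prop. 2.17–2.18]
* H. Niederreiter, *Random Number Generation and Quasi-Monte Carlo Methods*, CBMS-NSF 63, SIAM
  1992, Theorem 2.11 and eq. (2.5); Def. 2.1 and the remark `0 ≤ D_N ≤ 1` (p. 14).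
  [cite: Niederreiter1992, Thm 2.11]
* E. Hlawka, *Funktionen von beschränkter Variation in der Theorie der Gleichverteilung*,
  Ann. Mat. Pura Appl. 54 (1961) 325–333 (the original, Hardy–Krause variation).
* S. K. Zaremba, *Some applications of multidimensional integration by parts*,
  Ann. Polon. Math. 21 (1968) 85–96 (the identity).
* L. Kuipers, H. Niederreiter, *Uniform Distribution of Sequences*, Wiley 1974, Ch. 2 §5,
  Theorem 5.5. [cite: KuipersNiederreiter1974, Ch. 2 Thm 5.5]

AI-produced formalisation (H21 engines group, seat eng-quad-3, 2026-08-21); no facts, no axioms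
beyond Mathlib's, no `sorry`.
-/

noncomputable section

namespace Literature.NumberTheory.DiophantineApproximation

namespace Discrepancy

open MeasureTheory Set intervalIntegral Function Finset

variable {N s : ℕ}

/-! ### Counting function, local discrepancy and star discrepancy on `[0,1]^s` -/

/-- `#{n : x_n ∈ [0, z)}`: the number of points `x_n` with `x_{n,i} < z_i` for every coordinate
`i` (points of `[0,1)^s`, anchored half-open box `∏_i [0, z_i)`). [folklore] -/
def boxCount (x : Fin N → Fin s → ℝ) (z : Fin s → ℝ) : ℕ :=
  (univ.filter fun n => ∀ i, x n i < z i).card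

/-- The local discrepancy `Δ_P(z) = #{n : x_n ∈ [0, z)}/N − ∏_i z_i` of the point set
`P = {x_0, …, x_{N−1}}`. [cite: DickPillichshammer2010, §2.4 (proof of Prop. 2.17, p. 33)] -/
def boxDelta (x : Fin N → Fin s → ℝ) (z : Fin s → ℝ) : ℝ :=
  (boxCount x z : ℝ) / N - ∏ i, z i

/-- The star discrepancy `D*_N(P) = sup_{z ∈ [0,1]^s} |Δ_P(z)|`.
[cite: DickPillichshammer2010, Def. 2.14; Niederreiter1992, Def. 2.1] -/
def starDiscrepancy (x : Fin N → Fin s → ℝ) : ℝ :=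
  sSup ((fun z => |boxDelta x z|) '' Icc (0 : Fin s → ℝ) 1)

/-- `(z_u, 1)`: the point of `[0,1]^s` whose `i`-th coordinate is `z_i` if `i ∈ u` and `1` if
`i ∉ u` [cite: DickPillichshammer2010, §2.4 p. 33 (notation `(x_u, 1)`)]. -/
def projOne (u : Finset (Fin s)) (z : Fin s → ℝ) : Fin s → ℝ :=
  fun i => if i ∈ u then z i else 1

variable (x : Fin N → Fin s → ℝ)

/-- `#{n : x_n ∈ [0,z)} ≤ N`. [folklore] -/
private theorem boxCount_le (z : Fin s → ℝ) : boxCount x z ≤ N :=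
  (card_le_univ _).trans (by simp)

/-- `#{n : x_n ∈ [0,z)} = Σ_n ∏_i 1[x_{n,i} < z_i]`. [folklore] -/
private theorem boxCount_eq_sum (z : Fin s → ℝ) :
    (boxCount x z : ℝ) = ∑ n, ∏ i, (if x n i < z i then (1 : ℝ) else 0) := by
  unfold boxCount
  rw [card_filter]
  push_cast
  refine sum_congr rfl fun n _ => ?_
  by_cases h : ∀ i, x n i < z i
  · rw [if_pos h]
    exact (prod_eq_one fun i _ => if_pos (h i)).symm
  · rw [if_neg h]
    push Not at h
    obtain ⟨i, hi⟩ := h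
    exact (prod_eq_zero (mem_univ i) (if_neg (not_lt.2 hi))).symm

/-- On the face map: for points of `[0,1)^s`, `#{n : x_n ∈ [0,(z_u,1))} = Σ_n ∏_{i∈u} 1[x_{n,i} < z_i]`
(the conditions `x_{n,i} < 1`, `i ∉ u`, are automatic). [folklore] -/
private theorem boxCount_projOne (hx1 : ∀ n i, x n i < 1) (u : Finset (Fin s)) (z : Fin s → ℝ) :
    (boxCount x (projOne u z) : ℝ) = ∑ n, ∏ i ∈ u, (if x n i < z i then (1 : ℝ) else 0) := by
  unfold boxCount
  rw [card_filter]
  push_cast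
  refine sum_congr rfl fun n _ => ?_
  by_cases h : ∀ i ∈ u, x n i < z i
  · have h' : ∀ i, x n i < projOne u z i := fun i => by
      by_cases hi : i ∈ u
      · simpa [projOne, hi] using h i hi
      · simpa [projOne, hi] using hx1 n i
    rw [if_pos h']
    exact (prod_eq_one fun i hi => if_pos (h i hi)).symm
  · have h' : ¬ ∀ i, x n i < projOne u z i := fun h'' => h fun i hi => by
      simpa [projOne, hi] using h'' i
    rw [if_neg h']
    push Not at h
    obtain ⟨i, hi, hlt⟩ := h
    exact (prod_eq_zero hi (if_neg (not_lt.2 hlt))).symm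

/-- `∏_i (z_u,1)_i = ∏_{i∈u} z_i`. [folklore] -/
private theorem prod_projOne (u : Finset (Fin s)) (z : Fin s → ℝ) :
    ∏ i, projOne u z i = ∏ i ∈ u, z i := by
  simp only [projOne]
  rw [prod_ite_mem, Finset.univ_inter]

/-- `Δ_P(z_u, 1) = (1/N) Σ_n ∏_{i∈u} 1[x_{n,i} < z_i] − ∏_{i∈u} z_i` for points of `[0,1)^s`
("`∂h/∂x_u (x_u,1) = (1/N) Σ_n χ_{[0,y_u)}(x_u) − ∏_{i∈u} x_i = Δ_P(x_u,1)`").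
[cite: DickPillichshammer2010, §2.4, proof of Prop. 2.17 (p. 33)] -/
theorem boxDelta_projOne (hx1 : ∀ n i, x n i < 1) (u : Finset (Fin s)) (z : Fin s → ℝ) :
    boxDelta x (projOne u z) =
      (∑ n, ∏ i ∈ u, (if x n i < z i then (1 : ℝ) else 0)) / N - ∏ i ∈ u, z i := by
  rw [boxDelta, boxCount_projOne x hx1, prod_projOne]

/-- `Δ_P(x_∅, 1) = Δ_P(1) = 0` for `N ≥ 1` points of `[0,1)^s`.
[cite: DickPillichshammer2010, §2.4, proof of Prop. 2.17 (p. 33)] -/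
theorem boxDelta_projOne_empty (hN : 0 < N) (hx1 : ∀ n i, x n i < 1) (z : Fin s → ℝ) :
    boxDelta x (projOne ∅ z) = 0 := by
  rw [boxDelta_projOne x hx1]
  have hNr : (N : ℝ) ≠ 0 := by exact_mod_cast hN.ne'
  simp [hNr]

/-- `0 ≤ ∏_{i∈u} z_i ≤ 1` on the cube. [folklore] -/
private theorem prod_mem_unitInterval {z : Fin s → ℝ} (hz : z ∈ Icc (0 : Fin s → ℝ) 1)
    (u : Finset (Fin s)) : 0 ≤ ∏ i ∈ u, z i ∧ ∏ i ∈ u, z i ≤ 1 :=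
  ⟨prod_nonneg fun i _ => hz.1 i, prod_le_one (fun i _ => hz.1 i) fun i _ => hz.2 i⟩

/-- `|Δ_P(z)| ≤ 1` on the cube. [folklore] -/
private theorem abs_boxDelta_le_one {z : Fin s → ℝ} (hz : z ∈ Icc (0 : Fin s → ℝ) 1) :
    |boxDelta x z| ≤ 1 := by
  unfold boxDelta
  have h1 : 0 ≤ (boxCount x z : ℝ) / N := by positivity
  have h2 : (boxCount x z : ℝ) / N ≤ 1 := by
    rcases Nat.eq_zero_or_pos N with hN | hN
    · subst hN; simp
    · rw [div_le_one (by exact_mod_cast hN)]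
      exact_mod_cast boxCount_le x z
  have h3 := prod_mem_unitInterval hz univ
  rw [abs_le]
  constructor <;> linarith [h3.1, h3.2]

/-- The defining set of the star discrepancy is bounded above (by `1`). [folklore] -/
private theorem bddAbove_abs_boxDelta :
    BddAbove ((fun z => |boxDelta x z|) '' Icc (0 : Fin s → ℝ) 1) := by
  refine ⟨1, ?_⟩
  rintro _ ⟨z, hz, rfl⟩
  exact abs_boxDelta_le_one x hz

/-- `|Δ_P(z)| ≤ D*_N` on the cube (the star discrepancy is the supremum of `|Δ_P|` over the
anchored boxes). [cite: Niederreiter1992, Def. 2.1; DickPillichshammer2010, Def. 2.14] -/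
theorem abs_boxDelta_le_starDiscrepancy {z : Fin s → ℝ} (hz : z ∈ Icc (0 : Fin s → ℝ) 1) :
    |boxDelta x z| ≤ starDiscrepancy x :=
  le_csSup (bddAbove_abs_boxDelta x) ⟨z, hz, rfl⟩

/-- `0 ≤ D*_N`: "Note that `0 ≤ D_N(𝓑; P) ≤ 1` always". [cite: Niederreiter1992, §2.1 p. 14] -/
theorem starDiscrepancy_nonneg : 0 ≤ starDiscrepancy x :=
  (abs_nonneg _).trans (abs_boxDelta_le_starDiscrepancy x ⟨le_rfl, zero_le_one⟩)

/-- `D*_N ≤ 1`: "Note that `0 ≤ D_N(𝓑; P) ≤ 1` always". [cite: Niederreiter1992, §2.1 p. 14] -/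
theorem starDiscrepancy_le_one : starDiscrepancy x ≤ 1 :=
  csSup_le ⟨_, ⟨0, ⟨le_rfl, zero_le_one⟩, rfl⟩⟩
    (by rintro _ ⟨z, hz, rfl⟩; exact abs_boxDelta_le_one x hz)

/-- `Δ_P` is measurable (a finite sum of products of indicators of half-spaces, minus a
polynomial). [folklore] -/
private theorem measurable_boxDelta : Measurable (boxDelta x) := by
  have h : boxDelta x = fun z => (∑ n, ∏ i, (if x n i < z i then (1 : ℝ) else 0)) / N - ∏ i, z i := by
    funext z; rw [boxDelta, boxCount_eq_sum]
  rw [h]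
  refine Measurable.sub (Measurable.div_const (Finset.measurable_sum _ fun n _ => ?_) _)
    (Finset.measurable_prod _ fun i _ => measurable_pi_apply i)
  exact Finset.measurable_prod _ fun i _ =>
    Measurable.ite (measurableSet_lt measurable_const (measurable_pi_apply i)) measurable_const
      measurable_const

/-! ### The face map -/

/-- `(z_u,1) ∈ [0,1]^s` for `z ∈ [0,1]^s`. [folklore] -/
private theorem projOne_mem_Icc (u : Finset (Fin s)) {z : Fin s → ℝ}
    (hz : z ∈ Icc (0 : Fin s → ℝ) 1) : projOne u z ∈ Icc (0 : Fin s → ℝ) 1 := by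
  have hz' : ∀ i, 0 ≤ z i ∧ z i ≤ 1 := fun i => ⟨hz.1 i, hz.2 i⟩
  constructor <;> intro i <;> by_cases hi : i ∈ u <;>
    simp only [projOne, hi, if_true, if_false, Pi.zero_apply, Pi.one_apply] <;>
    first | exact (hz' i).1 | exact (hz' i).2 | exact zero_le_one | exact le_rfl

/-- `z ↦ (z_u,1)` is continuous. [folklore] -/
private theorem continuous_projOne (u : Finset (Fin s)) :
    Continuous (projOne u : (Fin s → ℝ) → Fin s → ℝ) := by
  refine continuous_pi fun i => ?_
  by_cases hi : i ∈ u <;> simp only [projOne, hi, if_true, if_false] <;>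
    first | exact continuous_apply i | exact continuous_const

/-- `z[i ↦ t] ∈ [0,1]^s` for `z ∈ [0,1]^s`, `t ∈ [0,1]`. [folklore] -/
private theorem update_mem_Icc {z : Fin s → ℝ} (hz : z ∈ Icc (0 : Fin s → ℝ) 1) (i : Fin s)
    {t : ℝ} (ht : t ∈ Icc (0 : ℝ) 1) : update z i t ∈ Icc (0 : Fin s → ℝ) 1 := by
  have hz' : ∀ j, 0 ≤ z j ∧ z j ≤ 1 := fun j => ⟨hz.1 j, hz.2 j⟩
  constructor <;> intro j <;> rcases eq_or_ne j i with rfl | hj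
  · simpa using ht.1
  · simpa [update_of_ne hj] using (hz' j).1
  · simpa using ht.2
  · simpa [update_of_ne hj] using (hz' j).2

/-! ### Calculus on the unit cube: integrability, and integrating out one coordinate -/

/-- A bounded measurable weight times a continuous function of a continuous self-map of the cube
is integrable on the cube. [folklore] -/
private theorem integrableOn_mul_comp {G : (Fin s → ℝ) → ℝ} (hG : ContinuousOn G (Icc 0 1))
    {P : (Fin s → ℝ) → (Fin s → ℝ)} (hP : Continuous P) (hPI : MapsTo P (Icc 0 1) (Icc 0 1))
    {ψ : (Fin s → ℝ) → ℝ} (hψ : Measurable ψ) (hψb : ∀ z ∈ Icc (0 : Fin s → ℝ) 1, |ψ z| ≤ 1) :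
    IntegrableOn (fun z => ψ z * G (P z)) (Icc (0 : Fin s → ℝ) 1) := by
  have hGP : IntegrableOn (fun z => G (P z)) (Icc (0 : Fin s → ℝ) 1) :=
    (hG.comp hP.continuousOn hPI).integrableOn_compact isCompact_Icc
  refine Integrable.bdd_mul (c := 1) hGP hψ.aestronglyMeasurable ?_
  exact (ae_restrict_iff' measurableSet_Icc).2
    (Filter.Eventually.of_forall fun z hz => by rw [Real.norm_eq_abs]; exact hψb z hz)

/-- Lebesgue measure on the unit cube is the product of `s` copies of Lebesgue measure on
`[0,1]`. [folklore] -/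
private theorem volume_restrict_unitCube (s : ℕ) :
    (volume : Measure (Fin s → ℝ)).restrict (Icc 0 1) =
      Measure.pi fun _ : Fin s => (volume : Measure ℝ).restrict (Icc 0 1) := by
  rw [← Set.pi_univ_Icc, volume_pi, Measure.restrict_pi_pi]
  rfl

/-- `z[i ↦ t] = insertNth i t (removeNth i z)`. [folklore] -/
private theorem update_eq_insertNth {m : ℕ} (i : Fin (m + 1)) (z : Fin (m + 1) → ℝ) (t : ℝ) :
    update z i t = i.insertNth t (i.removeNth z) :=
  (Fin.insertNth_removeNth i t z).symm

/-- **Integrating out one coordinate** (Fubini on `[0,1]^s ≅ [0,1] × [0,1]^{s−1}` at the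
coordinate `i`): for `G` integrable on the cube, `z ↦ ∫₀¹ G(z[i ↦ t]) dt` is integrable on the
cube and has the same integral as `G`. [folklore] -/
private theorem integral_unitCube_eq_integral_update (i : Fin s) {G : (Fin s → ℝ) → ℝ}
    (hG : IntegrableOn G (Icc (0 : Fin s → ℝ) 1)) :
    IntegrableOn (fun z => ∫ t in (0 : ℝ)..1, G (update z i t)) (Icc (0 : Fin s → ℝ) 1) ∧
      ∫ z in Icc (0 : Fin s → ℝ) 1, G z =
        ∫ z in Icc (0 : Fin s → ℝ) 1, ∫ t in (0 : ℝ)..1, G (update z i t) := by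
  obtain ⟨m, rfl⟩ : ∃ m, s = m + 1 := ⟨s - 1, by have := i.pos; omega⟩
  set ν : Measure ℝ := (volume : Measure ℝ).restrict (Icc 0 1) with hν
  haveI : IsFiniteMeasure ν :=
    ⟨by rw [hν, Measure.restrict_apply_univ]; exact measure_Icc_lt_top⟩
  have hν1 : ν.real univ = 1 := by
    rw [measureReal_def, hν, Measure.restrict_apply_univ, Real.volume_Icc, sub_zero,
      ENNReal.toReal_ofReal zero_le_one]
  set π' : Measure (Fin m → ℝ) := Measure.pi fun _ : Fin m => ν with hπ'
  set e := MeasurableEquiv.piFinSuccAbove (fun _ : Fin (m + 1) => ℝ) i with he_def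
  have he : MeasurePreserving e ((volume : Measure (Fin (m + 1) → ℝ)).restrict (Icc 0 1))
      (ν.prod π') := by
    rw [volume_restrict_unitCube]
    exact measurePreserving_piFinSuccAbove (fun _ : Fin (m + 1) => ν) i
  set H : (Fin m → ℝ) → ℝ := fun z' => ∫ t in Icc (0 : ℝ) 1, G (i.insertNth t z') with hH
  have hGe : Integrable (fun p : ℝ × (Fin m → ℝ) => G (e.symm p)) (ν.prod π') :=
    (he.symm.integrable_comp_emb e.symm.measurableEmbedding).mpr hG
  have hHint : Integrable H π' := hGe.integral_prod_right
  have hpt : ∀ z : Fin (m + 1) → ℝ, ∫ t in (0 : ℝ)..1, G (update z i t) = H (e z).2 := by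
    intro z
    rw [intervalIntegral.integral_of_le zero_le_one, ← integral_Icc_eq_integral_Ioc]
    simp only [hH, update_eq_insertNth]
    rfl
  have hfun : (fun z : Fin (m + 1) → ℝ => ∫ t in (0 : ℝ)..1, G (update z i t)) =
      fun z => H (e z).2 := funext hpt
  refine ⟨?_, ?_⟩
  · rw [IntegrableOn, hfun]
    exact (he.integrable_comp_emb e.measurableEmbedding).mpr (hHint.comp_snd ν)
  · have h2 : ∫ z in Icc (0 : Fin (m + 1) → ℝ) 1, H (e z).2 = ∫ p, H p.2 ∂(ν.prod π') := by
      rw [← he.integral_comp' (fun p : ℝ × (Fin m → ℝ) => H p.2)]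
    have h3 : ∫ p, H p.2 ∂(ν.prod π') = ∫ z', H z' ∂π' := by
      rw [integral_fun_snd, hν1, one_smul]
    have h4 : ∫ z in Icc (0 : Fin (m + 1) → ℝ) 1, G z = ∫ z', H z' ∂π' := by
      rw [← he.symm.integral_comp', integral_prod_symm _ hGe]
      rfl
    rw [hfun, h2, h3, h4]

/-- Integration by parts on `[0,1]`: `∫₀¹ t g'(t) dt = g(1) − ∫₀¹ g`. [folklore] -/
private theorem integral_id_mul_deriv' {g g' : ℝ → ℝ}
    (hg : ∀ t ∈ Icc (0 : ℝ) 1, HasDerivAt g (g' t) t) (hg' : ContinuousOn g' (Icc (0 : ℝ) 1)) :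
    ∫ t in (0 : ℝ)..1, t * g' t = g 1 - ∫ t in (0 : ℝ)..1, g t := by
  have hg'int : IntervalIntegrable g' volume 0 1 :=
    (hg'.mono (by rw [Set.uIcc_of_le zero_le_one])).intervalIntegrable
  have h := integral_mul_deriv_eq_deriv_mul (u := fun t => t) (u' := fun _ => (1 : ℝ)) (v := g)
    (v' := g') (a := 0) (b := 1) (fun t _ => hasDerivAt_id t)
    (fun t ht => hg t (by rwa [Set.uIcc_of_le zero_le_one] at ht)) intervalIntegrable_const hg'int
  rw [h]
  simp

/-! ### The expansion lemma (induction over the treated coordinates) -/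

section Expansion

variable {κ φ : Fin s → ℝ → ℝ} {F : Finset (Fin s) → (Fin s → ℝ) → ℝ}

/-- Book-keeping point of the induction: coordinates in `u` are free (`z_i`), treated
coordinates outside `u` are frozen at `1`, untreated ones carry the kernel `κ_i(z_i)`.
[folklore] -/
private def mixPt (κ : Fin s → ℝ → ℝ) (w u : Finset (Fin s)) (z : Fin s → ℝ) : Fin s → ℝ :=
  fun i => if i ∈ u then z i else if i ∈ w then 1 else κ i (z i)

/-- `mixPt` maps the cube to the cube when the kernels map `[0,1]` to `[0,1]`. [folklore] -/
private theorem mixPt_mem_Icc (hκI : ∀ i, ∀ t ∈ Icc (0 : ℝ) 1, κ i t ∈ Icc (0 : ℝ) 1)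
    (w u : Finset (Fin s)) {z : Fin s → ℝ} (hz : z ∈ Icc (0 : Fin s → ℝ) 1) :
    mixPt κ w u z ∈ Icc (0 : Fin s → ℝ) 1 := by
  have hz' : ∀ i, z i ∈ Icc (0 : ℝ) 1 := fun i => ⟨hz.1 i, hz.2 i⟩
  constructor <;> intro i <;> by_cases hu : i ∈ u <;> by_cases hw : i ∈ w <;>
    simp only [mixPt, hu, hw, if_true, if_false, Pi.zero_apply, Pi.one_apply] <;>
    first
      | exact (hz' i).1 | exact (hz' i).2 | exact zero_le_one | exact le_rfl
      | exact (hκI i _ (hz' i)).1 | exact (hκI i _ (hz' i)).2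

/-- `mixPt` is continuous when the kernels are. [folklore] -/
private theorem continuous_mixPt (hκc : ∀ i, Continuous (κ i)) (w u : Finset (Fin s)) :
    Continuous (mixPt κ w u) := by
  refine continuous_pi fun i => ?_
  by_cases hu : i ∈ u <;> by_cases hw : i ∈ w <;>
    simp only [mixPt, hu, hw, if_true, if_false] <;>
    first
      | exact continuous_apply i | exact continuous_const
      | exact (hκc i).comp (continuous_apply i)

/-- Moving the `j`-th coordinate (`j` untreated, not free): `mixPt_w^u(z[j ↦ t])` is
`mixPt_{w∪{j}}^u(z)` with its `j`-th coordinate set to `κ_j(t)`. [folklore] -/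
private theorem mixPt_update {w u : Finset (Fin s)} {j : Fin s} (hjw : j ∉ w) (hju : j ∉ u)
    (z : Fin s → ℝ) (t : ℝ) :
    mixPt κ w u (update z j t) = update (mixPt κ (insert j w) u z) j (κ j t) := by
  funext i
  rcases eq_or_ne i j with rfl | hij
  · simp [mixPt, hju, hjw]
  · simp [mixPt, hij]

/-- Freeing the `j`-th coordinate: `mixPt_{w∪{j}}^{u∪{j}}(z[j ↦ t]) = mixPt_{w∪{j}}^u(z)[j ↦ t]`.
[folklore] -/
private theorem mixPt_insert_update (w u : Finset (Fin s)) (j : Fin s) (z : Fin s → ℝ) (t : ℝ) :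
    mixPt κ (insert j w) (insert j u) (update z j t) = update (mixPt κ (insert j w) u z) j t := by
  funext i
  rcases eq_or_ne i j with rfl | hij
  · simp [mixPt]
  · simp [mixPt, hij]

/-- A treated, non-free coordinate already equals `1`. [folklore] -/
private theorem update_mixPt_one {w u : Finset (Fin s)} {j : Fin s} (hjw : j ∈ w) (hju : j ∉ u)
    (z : Fin s → ℝ) : update (mixPt κ w u z) j 1 = mixPt κ w u z := by
  funext i
  rcases eq_or_ne i j with rfl | hij
  · simp [mixPt, hjw, hju]
  · simp [hij]

/-- With no coordinate treated, `mixPt_∅^∅(z) = κ(z)`. [folklore] -/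
private theorem mixPt_empty (z : Fin s → ℝ) : mixPt κ ∅ ∅ z = fun i => κ i (z i) := by
  funext i
  simp [mixPt]

/-- With every coordinate treated, `mixPt_{I_s}^u(z) = (z_u, 1)`. [folklore] -/
private theorem mixPt_univ (u : Finset (Fin s)) (z : Fin s → ℝ) :
    mixPt κ univ u z = projOne u z := by
  funext i
  simp [mixPt, projOne]

/-- The weight `∏_{i∈u} φ_i(z_i)` does not see an update at `j ∉ u`. [folklore] -/
private theorem prod_update_of_not_mem {u : Finset (Fin s)} {j : Fin s} (hju : j ∉ u)
    (z : Fin s → ℝ) (t : ℝ) :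
    ∏ i ∈ u, φ i (update z j t i) = ∏ i ∈ u, φ i (z i) :=
  prod_congr rfl fun i hi => by rw [update_of_ne (ne_of_mem_of_not_mem hi hju)]

/-- `∏_{i∈u∪{j}} φ_i(z[j ↦ t]_i) = φ_j(t) ∏_{i∈u} φ_i(z_i)` for `j ∉ u`. [folklore] -/
private theorem prod_insert_update {u : Finset (Fin s)} {j : Fin s} (hju : j ∉ u)
    (z : Fin s → ℝ) (t : ℝ) :
    ∏ i ∈ insert j u, φ i (update z j t i) = φ j t * ∏ i ∈ u, φ i (z i) := by
  rw [prod_insert hju, update_self, prod_update_of_not_mem hju]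

/-- Every term of the expansion is integrable on the cube. [folklore] -/
private theorem integrableOn_term (hκc : ∀ i, Continuous (κ i))
    (hκI : ∀ i, ∀ t ∈ Icc (0 : ℝ) 1, κ i t ∈ Icc (0 : ℝ) 1) (hφm : ∀ i, Measurable (φ i))
    (hφb : ∀ i, ∀ t ∈ Icc (0 : ℝ) 1, |φ i t| ≤ 1) (hFc : ∀ u, ContinuousOn (F u) (Icc 0 1))
    (w u : Finset (Fin s)) :
    IntegrableOn (fun z => (∏ i ∈ u, φ i (z i)) * F u (mixPt κ w u z)) (Icc (0 : Fin s → ℝ) 1) :=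
  integrableOn_mul_comp (hFc u) (continuous_mixPt hκc w u) (fun _ hz => mixPt_mem_Icc hκI w u hz)
    (Finset.measurable_prod u fun i _ => (hφm i).comp (measurable_pi_apply i))
    fun z hz => by
      rw [Finset.abs_prod]
      exact prod_le_one (fun i _ => abs_nonneg _) fun i _ => hφb i (z i) ⟨hz.1 i, hz.2 i⟩

/-- **Induction step**: treating one more coordinate `j ∉ w` splits the term of `u ⊆ w` into the
terms of `u` and of `u ∪ {j}` at level `w ∪ {j}` — Fubini at the coordinate `j` and the
one-dimensional rule `∫₀¹ g(κ_j t) dt = g(1) − ∫₀¹ φ_j g′` applied to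
`g(t) = (∂^{|u|}f/∂x_u)(mixPt[j ↦ t])`, whose derivative is the next mixed partial. [folklore] -/
private theorem term_split (hκc : ∀ i, Continuous (κ i))
    (hκI : ∀ i, ∀ t ∈ Icc (0 : ℝ) 1, κ i t ∈ Icc (0 : ℝ) 1) (hφm : ∀ i, Measurable (φ i))
    (hφb : ∀ i, ∀ t ∈ Icc (0 : ℝ) 1, |φ i t| ≤ 1)
    (h1d : ∀ i, ∀ g g' : ℝ → ℝ, (∀ t ∈ Icc (0 : ℝ) 1, HasDerivAt g (g' t) t) →
      ContinuousOn g' (Icc (0 : ℝ) 1) →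
      ∫ t in (0 : ℝ)..1, g (κ i t) = g 1 - ∫ t in (0 : ℝ)..1, φ i t * g' t)
    (hFc : ∀ u, ContinuousOn (F u) (Icc 0 1))
    (hFd : ∀ u i, i ∉ u → ∀ z ∈ Icc (0 : Fin s → ℝ) 1,
      HasDerivAt (fun t => F u (update z i t)) (F (insert i u) z) (z i))
    {w u : Finset (Fin s)} {j : Fin s} (hjw : j ∉ w) (hu : u ⊆ w) :
    ∫ z in Icc (0 : Fin s → ℝ) 1, (∏ i ∈ u, φ i (z i)) * F u (mixPt κ w u z) =
      (∫ z in Icc (0 : Fin s → ℝ) 1, (∏ i ∈ u, φ i (z i)) * F u (mixPt κ (insert j w) u z)) -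
        ∫ z in Icc (0 : Fin s → ℝ) 1,
          (∏ i ∈ insert j u, φ i (z i)) * F (insert j u) (mixPt κ (insert j w) (insert j u) z) := by
  have hju : j ∉ u := fun h => hjw (hu h)
  obtain ⟨-, hAeq⟩ := integral_unitCube_eq_integral_update j
    (integrableOn_term hκc hκI hφm hφb hFc w u)
  obtain ⟨hBint, hBeq⟩ := integral_unitCube_eq_integral_update j
    (integrableOn_term hκc hκI hφm hφb hFc (insert j w) (insert j u))
  -- pointwise on the cube: integrate out the `j`-th coordinate
  have hpt : ∀ z ∈ Icc (0 : Fin s → ℝ) 1,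
      ∫ t in (0 : ℝ)..1, (∏ i ∈ u, φ i (update z j t i)) * F u (mixPt κ w u (update z j t)) =
        (∏ i ∈ u, φ i (z i)) * F u (mixPt κ (insert j w) u z) -
          ∫ t in (0 : ℝ)..1, (∏ i ∈ insert j u, φ i (update z j t i)) *
            F (insert j u) (mixPt κ (insert j w) (insert j u) (update z j t)) := by
    intro z hz
    have hm : mixPt κ (insert j w) u z ∈ Icc (0 : Fin s → ℝ) 1 := mixPt_mem_Icc hκI _ _ hz
    have hg : ∀ τ ∈ Icc (0 : ℝ) 1,
        HasDerivAt (fun t => F u (update (mixPt κ (insert j w) u z) j t))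
          (F (insert j u) (update (mixPt κ (insert j w) u z) j τ)) τ := by
      intro τ hτ
      have h := hFd u j hju (update (mixPt κ (insert j w) u z) j τ) (update_mem_Icc hm j hτ)
      simp only [update_idem, update_self] at h
      exact h
    have hcu : Continuous fun τ : ℝ => update (mixPt κ (insert j w) u z) j τ :=
      continuous_const.update j continuous_id
    have hg' : ContinuousOn (fun τ => F (insert j u) (update (mixPt κ (insert j w) u z) j τ))
        (Icc (0 : ℝ) 1) :=
      (hFc (insert j u)).comp hcu.continuousOn fun τ hτ => update_mem_Icc hm j hτ
    have h1 := h1d j _ _ hg hg'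
    rw [update_mixPt_one (mem_insert_self j w) hju] at h1
    have hAt : ∀ t, (∏ i ∈ u, φ i (update z j t i)) * F u (mixPt κ w u (update z j t)) =
        (∏ i ∈ u, φ i (z i)) * F u (update (mixPt κ (insert j w) u z) j (κ j t)) := fun t => by
      rw [prod_update_of_not_mem hju, mixPt_update hjw hju]
    have hBt : ∀ t, (∏ i ∈ insert j u, φ i (update z j t i)) *
        F (insert j u) (mixPt κ (insert j w) (insert j u) (update z j t)) =
        (∏ i ∈ u, φ i (z i)) * (φ j t * F (insert j u) (update (mixPt κ (insert j w) u z) j t)) :=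
      fun t => by
        rw [prod_insert_update hju, mixPt_insert_update]
        ring
    simp_rw [hAt, hBt]
    rw [intervalIntegral.integral_const_mul, intervalIntegral.integral_const_mul, h1, mul_sub]
  rw [hAeq, setIntegral_congr_fun measurableSet_Icc hpt,
    integral_sub (integrableOn_term hκc hκI hφm hφb hFc (insert j w) u) hBint, ← hBeq]

/-- **The expansion lemma.** For kernels `κ_i : [0,1] → [0,1]` and weights `|φ_i| ≤ 1` obeying
the one-dimensional rule `∫₀¹ g(κ_i t) dt = g(1) − ∫₀¹ φ_i(t) g′(t) dt` (`g ∈ C¹[0,1]`), and every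
set `w` of treated coordinates,
`∫_{[0,1]^s} f(κ(z)) dz = Σ_{u ⊆ w} (−1)^{|u|} ∫_{[0,1]^s} (∏_{i∈u} φ_i(z_i)) (∂^{|u|}f/∂x_u)(mixPt_w^u(z)) dz`.
[folklore] -/
private theorem expansion (hκc : ∀ i, Continuous (κ i))
    (hκI : ∀ i, ∀ t ∈ Icc (0 : ℝ) 1, κ i t ∈ Icc (0 : ℝ) 1) (hφm : ∀ i, Measurable (φ i))
    (hφb : ∀ i, ∀ t ∈ Icc (0 : ℝ) 1, |φ i t| ≤ 1)
    (h1d : ∀ i, ∀ g g' : ℝ → ℝ, (∀ t ∈ Icc (0 : ℝ) 1, HasDerivAt g (g' t) t) →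
      ContinuousOn g' (Icc (0 : ℝ) 1) →
      ∫ t in (0 : ℝ)..1, g (κ i t) = g 1 - ∫ t in (0 : ℝ)..1, φ i t * g' t)
    (hFc : ∀ u, ContinuousOn (F u) (Icc 0 1))
    (hFd : ∀ u i, i ∉ u → ∀ z ∈ Icc (0 : Fin s → ℝ) 1,
      HasDerivAt (fun t => F u (update z i t)) (F (insert i u) z) (z i))
    (w : Finset (Fin s)) :
    ∫ z in Icc (0 : Fin s → ℝ) 1, F ∅ (fun i => κ i (z i)) =
      ∑ u ∈ w.powerset, (-1 : ℝ) ^ u.card *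
        ∫ z in Icc (0 : Fin s → ℝ) 1, (∏ i ∈ u, φ i (z i)) * F u (mixPt κ w u z) := by
  induction w using Finset.induction_on with
  | empty =>
    simp [mixPt_empty]
  | insert j w hjw ih =>
    rw [ih, sum_powerset_insert hjw, ← sum_add_distrib]
    refine sum_congr rfl fun u hu => ?_
    have hu' : u ⊆ w := mem_powerset.1 hu
    have hju : j ∉ u := fun h => hjw (hu' h)
    rw [term_split hκc hκI hφm hφb h1d hFc hFd hjw hu', card_insert_of_notMem hju, pow_succ]
    ring

end Expansion

/-! ### The two instances: one point (`κ ≡ y`, `φ = 1[y < ·]`) and the integral (`κ = φ = id`) -/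

variable {F : Finset (Fin s) → (Fin s → ℝ) → ℝ}

/-- Expansion of `f(y)` for one point `y ∈ [0,1)^s` (fundamental theorem of calculus in each
variable on `[y_i, 1]`):
`f(y) = Σ_u (−1)^{|u|} ∫_{[0,1]^s} (∏_{i∈u} 1[y_i < z_i]) (∂^{|u|}f/∂x_u)(z_u,1) dz`. [folklore] -/
private theorem point_expansion {y : Fin s → ℝ} (hy0 : ∀ i, 0 ≤ y i) (hy1 : ∀ i, y i < 1)
    (hFc : ∀ u, ContinuousOn (F u) (Icc 0 1))
    (hFd : ∀ u i, i ∉ u → ∀ z ∈ Icc (0 : Fin s → ℝ) 1,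
      HasDerivAt (fun t => F u (update z i t)) (F (insert i u) z) (z i)) :
    F ∅ y = ∑ u, (-1 : ℝ) ^ u.card *
      ∫ z in Icc (0 : Fin s → ℝ) 1,
        (∏ i ∈ u, if y i < z i then (1 : ℝ) else 0) * F u (projOne u z) := by
  have h := expansion (κ := fun i _ => y i) (φ := fun i t => if y i < t then (1 : ℝ) else 0)
    (F := F) (fun _ => continuous_const) (fun i _ _ => ⟨hy0 i, (hy1 i).le⟩)
    (fun i => Measurable.ite (measurableSet_lt measurable_const measurable_id) measurable_const
      measurable_const)
    (fun i t _ => by by_cases h : y i < t <;> simp [h])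
    (fun i g g' hg hg' => by
      rw [intervalIntegral.integral_const, integral_indicator_mul_deriv hg hg' (hy0 i) (hy1 i)]
      simp)
    hFc hFd univ
  beta_reduce at h
  have hcube : ∫ _ in Icc (0 : Fin s → ℝ) 1, F ∅ y = F ∅ y := by
    rw [setIntegral_const, measureReal_def, Real.volume_Icc_pi_toReal zero_le_one]
    simp
  rw [hcube, Finset.powerset_univ] at h
  refine h.trans (sum_congr rfl fun u _ => ?_)
  simp only [mixPt_univ]

/-- Expansion of the integral (integration by parts in each variable):
`∫_{[0,1]^s} f = Σ_u (−1)^{|u|} ∫_{[0,1]^s} (∏_{i∈u} z_i) (∂^{|u|}f/∂x_u)(z_u,1) dz`. [folklore] -/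
private theorem integral_expansion (hFc : ∀ u, ContinuousOn (F u) (Icc 0 1))
    (hFd : ∀ u i, i ∉ u → ∀ z ∈ Icc (0 : Fin s → ℝ) 1,
      HasDerivAt (fun t => F u (update z i t)) (F (insert i u) z) (z i)) :
    ∫ z in Icc (0 : Fin s → ℝ) 1, F ∅ z = ∑ u, (-1 : ℝ) ^ u.card *
      ∫ z in Icc (0 : Fin s → ℝ) 1, (∏ i ∈ u, z i) * F u (projOne u z) := by
  have h := expansion (κ := fun _ t => t) (φ := fun _ t => t) (F := F)
    (fun _ => continuous_id) (fun _ _ ht => ht) (fun _ => measurable_id)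
    (fun i t ht => by rw [abs_of_nonneg ht.1]; exact ht.2)
    (fun i g g' hg hg' => by
      rw [integral_id_mul_deriv' hg hg']
      ring)
    hFc hFd univ
  beta_reduce at h
  rw [Finset.powerset_univ] at h
  refine h.trans (sum_congr rfl fun u _ => ?_)
  simp only [mixPt_univ]

/-! ### Hlawka's identity and the Koksma–Hlawka inequality -/

/-- Every face term is integrable on the cube. [folklore] -/
private theorem integrableOn_face (hFc : ∀ u, ContinuousOn (F u) (Icc 0 1)) (u : Finset (Fin s))
    {ψ : (Fin s → ℝ) → ℝ} (hψ : Measurable ψ) (hψb : ∀ z ∈ Icc (0 : Fin s → ℝ) 1, |ψ z| ≤ 1) :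
    IntegrableOn (fun z => ψ z * F u (projOne u z)) (Icc (0 : Fin s → ℝ) 1) :=
  integrableOn_mul_comp (hFc u) (continuous_projOne u) (fun _ hz => projOne_mem_Icc u hz) hψ hψb

/-- **Hlawka's identity (Zaremba's identity)** [cite: DickPillichshammer2010, Prop. 2.17]: for
`N ≥ 1` points `x_n ∈ [0,1)^s` and `f` with continuous mixed partial derivatives
`F u = ∂^{|u|}f/∂x_u` on `[0,1]^s` (`F ∅ = f`),
`(1/N) Σ_n f(x_n) − ∫_{[0,1]^s} f = Σ_{∅ ≠ u ⊆ I_s} (−1)^{|u|} ∫_{[0,1]^s} Δ_P(z_u,1) (∂^{|u|}f/∂x_u)(z_u,1) dz`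
(the integrand depends on `z_u` only, so `∫_{[0,1]^s} … dz = ∫_{[0,1]^{|u|}} … dz_u`).
[cite: DickPillichshammer2010, Prop. 2.17] -/
theorem hlawka_zaremba_identity (hN : 0 < N) {x : Fin N → Fin s → ℝ}
    (hx0 : ∀ n i, 0 ≤ x n i) (hx1 : ∀ n i, x n i < 1)
    {f : (Fin s → ℝ) → ℝ} {F : Finset (Fin s) → (Fin s → ℝ) → ℝ} (hF : F ∅ = f)
    (hFc : ∀ u, ContinuousOn (F u) (Icc 0 1))
    (hFd : ∀ u i, i ∉ u → ∀ z ∈ Icc (0 : Fin s → ℝ) 1,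
      HasDerivAt (fun t => F u (update z i t)) (F (insert i u) z) (z i)) :
    (∑ n, f (x n)) / N - ∫ z in Icc (0 : Fin s → ℝ) 1, f z =
      ∑ u ∈ univ.filter Finset.Nonempty, (-1 : ℝ) ^ u.card *
        ∫ z in Icc (0 : Fin s → ℝ) 1, boxDelta x (projOne u z) * F u (projOne u z) := by
  subst hF
  -- integrability of the face terms
  have hIint : ∀ n u, IntegrableOn (fun z => (∏ i ∈ u, if x n i < z i then (1 : ℝ) else 0) *
      F u (projOne u z)) (Icc (0 : Fin s → ℝ) 1) := fun n u =>
    integrableOn_face hFc u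
      (Finset.measurable_prod u fun i _ => Measurable.ite
        (measurableSet_lt measurable_const (measurable_pi_apply i)) measurable_const
        measurable_const)
      fun z _ => by
        rw [Finset.abs_prod]
        exact prod_le_one (fun i _ => abs_nonneg _) fun i _ => by
          by_cases h : x n i < z i <;> simp [h]
  have hZint : ∀ u, IntegrableOn (fun z => (∏ i ∈ u, z i) * F u (projOne u z))
      (Icc (0 : Fin s → ℝ) 1) := fun u =>
    integrableOn_face hFc u (Finset.measurable_prod u fun i _ => measurable_pi_apply i)
      fun z hz => by
        rw [abs_of_nonneg (prod_mem_unitInterval hz u).1]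
        exact (prod_mem_unitInterval hz u).2
  -- the identity over all faces, `u = ∅` included
  have hfull : (∑ n, F ∅ (x n)) / N - ∫ z in Icc (0 : Fin s → ℝ) 1, F ∅ z =
      ∑ u, (-1 : ℝ) ^ u.card *
        ∫ z in Icc (0 : Fin s → ℝ) 1, boxDelta x (projOne u z) * F u (projOne u z) := by
    have hE1 : ∀ n, F ∅ (x n) = ∑ u, (-1 : ℝ) ^ u.card *
        ∫ z in Icc (0 : Fin s → ℝ) 1,
          (∏ i ∈ u, if x n i < z i then (1 : ℝ) else 0) * F u (projOne u z) :=
      fun n => point_expansion (fun i => hx0 n i) (fun i => hx1 n i) hFc hFd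
    simp_rw [hE1]
    rw [integral_expansion hFc hFd, sum_comm, sum_div, ← sum_sub_distrib]
    refine sum_congr rfl fun u _ => ?_
    rw [← mul_sum, mul_div_assoc, ← mul_sub]
    congr 1
    rw [← integral_finsetSum _ fun n _ => hIint n u, ← MeasureTheory.integral_div,
      ← integral_sub ((integrable_finsetSum _ fun n _ => hIint n u).div_const _) (hZint u)]
    refine setIntegral_congr_fun measurableSet_Icc fun z _ => ?_
    rw [boxDelta_projOne x hx1, ← sum_mul]
    ring
  have hfilter : (univ.filter Finset.Nonempty : Finset (Finset (Fin s))) = univ.erase ∅ := by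
    ext u
    simp [Finset.nonempty_iff_ne_empty]
  rw [hfull, hfilter]
  refine (sum_erase _ ?_).symm
  have h0 : ∫ z in Icc (0 : Fin s → ℝ) 1, boxDelta x (projOne ∅ z) * F ∅ (projOne ∅ z) = 0 :=
    setIntegral_eq_zero_of_forall_eq_zero fun z _ => by
      rw [boxDelta_projOne_empty x hN hx1, zero_mul]
  rw [h0, mul_zero]

/-- **Koksma–Hlawka inequality** [cite: DickPillichshammer2010, Prop. 2.18 with Remark 2.19] =
Hlawka's theorem [cite: Niederreiter1992, Thm 2.11 with eq. (2.5)] for integrands with continuous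
mixed partial derivatives: if `|Δ_P(z)| ≤ D` on `[0,1]^s` then
`|(1/N) Σ_n f(x_n) − ∫_{[0,1]^s} f| ≤ D · Σ_{∅ ≠ u ⊆ I_s} ∫_{[0,1]^s} |(∂^{|u|}f/∂x_u)(z_u,1)| dz`,
the sum being the variation of `f` on `[0,1]^s` in the sense of Hardy and Krause.
[cite: DickPillichshammer2010, Prop. 2.18] -/
theorem koksma_hlawka (hN : 0 < N) {x : Fin N → Fin s → ℝ}
    (hx0 : ∀ n i, 0 ≤ x n i) (hx1 : ∀ n i, x n i < 1)
    {f : (Fin s → ℝ) → ℝ} {F : Finset (Fin s) → (Fin s → ℝ) → ℝ} (hF : F ∅ = f)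
    (hFc : ∀ u, ContinuousOn (F u) (Icc 0 1))
    (hFd : ∀ u i, i ∉ u → ∀ z ∈ Icc (0 : Fin s → ℝ) 1,
      HasDerivAt (fun t => F u (update z i t)) (F (insert i u) z) (z i))
    {D : ℝ} (hD : ∀ z ∈ Icc (0 : Fin s → ℝ) 1, |boxDelta x z| ≤ D) :
    |(∑ n, f (x n)) / N - ∫ z in Icc (0 : Fin s → ℝ) 1, f z| ≤
      D * ∑ u ∈ univ.filter Finset.Nonempty,
        ∫ z in Icc (0 : Fin s → ℝ) 1, |F u (projOne u z)| := by
  rw [hlawka_zaremba_identity hN hx0 hx1 hF hFc hFd, mul_sum]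
  refine (abs_sum_le_sum_abs _ _).trans (sum_le_sum fun u _ => ?_)
  rw [abs_mul, abs_pow, abs_neg, abs_one, one_pow, one_mul]
  have hint : IntegrableOn (fun z => boxDelta x (projOne u z) * F u (projOne u z))
      (Icc (0 : Fin s → ℝ) 1) :=
    integrableOn_face hFc u ((measurable_boxDelta x).comp (continuous_projOne u).measurable)
      fun z hz => abs_boxDelta_le_one x (projOne_mem_Icc u hz)
  have habs : IntegrableOn (fun z => |F u (projOne u z)|) (Icc (0 : Fin s → ℝ) 1) := by
    have h1 : IntegrableOn (fun z => (1 : ℝ) * F u (projOne u z)) (Icc (0 : Fin s → ℝ) 1) :=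
      integrableOn_face hFc u measurable_const fun _ _ => by simp
    simp only [one_mul] at h1
    exact h1.abs
  calc |∫ z in Icc (0 : Fin s → ℝ) 1, boxDelta x (projOne u z) * F u (projOne u z)|
      ≤ ∫ z in Icc (0 : Fin s → ℝ) 1, |boxDelta x (projOne u z) * F u (projOne u z)| :=
        MeasureTheory.abs_integral_le_integral_abs
    _ ≤ ∫ z in Icc (0 : Fin s → ℝ) 1, D * |F u (projOne u z)| := by
        refine setIntegral_mono_on hint.abs (habs.const_mul D) measurableSet_Icc fun z hz => ?_
        rw [abs_mul]
        exact mul_le_mul_of_nonneg_right (hD _ (projOne_mem_Icc u hz)) (abs_nonneg _)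
    _ = D * ∫ z in Icc (0 : Fin s → ℝ) 1, |F u (projOne u z)| := MeasureTheory.integral_const_mul _ _

/-- **Koksma–Hlawka inequality with the star discrepancy** (`D = D*_N(P) = sup |Δ_P|`): the
literal shape of [cite: Niederreiter1992, Thm 2.11] (`≤ V(f) D*_N`) for integrands with continuous
mixed partial derivatives, `V(f) = Σ_{u ≠ ∅} ∫ |(∂^{|u|}f/∂x_u)(z_u,1)|`
[cite: DickPillichshammer2010, Remark 2.19]. [cite: Niederreiter1992, Thm 2.11] -/
theorem koksma_hlawka_starDiscrepancy (hN : 0 < N) {x : Fin N → Fin s → ℝ}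
    (hx0 : ∀ n i, 0 ≤ x n i) (hx1 : ∀ n i, x n i < 1)
    {f : (Fin s → ℝ) → ℝ} {F : Finset (Fin s) → (Fin s → ℝ) → ℝ} (hF : F ∅ = f)
    (hFc : ∀ u, ContinuousOn (F u) (Icc 0 1))
    (hFd : ∀ u i, i ∉ u → ∀ z ∈ Icc (0 : Fin s → ℝ) 1,
      HasDerivAt (fun t => F u (update z i t)) (F (insert i u) z) (z i)) :
    |(∑ n, f (x n)) / N - ∫ z in Icc (0 : Fin s → ℝ) 1, f z| ≤
      starDiscrepancy x * ∑ u ∈ univ.filter Finset.Nonempty,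
        ∫ z in Icc (0 : Fin s → ℝ) 1, |F u (projOne u z)| :=
  koksma_hlawka hN hx0 hx1 hF hFc hFd fun _ hz => abs_boxDelta_le_starDiscrepancy x hz

/-- **Koksma–Hlawka inequality, the `‖f‖_{s,1}` form** — the literal statement of
[cite: DickPillichshammer2010, Prop. 2.18]: `|I(f) − Q_N(f)| ≤ D*_N(P) ‖f‖_{s,1}` with
`‖f‖_{s,1} = Σ_{u ⊆ I_s} ∫ |(∂^{|u|}f/∂x_u)(z_u,1)|` summed over ALL `u` (the `u = ∅` summand is
`|f(1)|`; it is harmless and, by Remark 2.19, superfluous). [cite: DickPillichshammer2010, Prop. 2.18] -/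
theorem koksma_hlawka_norm_one (hN : 0 < N) {x : Fin N → Fin s → ℝ}
    (hx0 : ∀ n i, 0 ≤ x n i) (hx1 : ∀ n i, x n i < 1)
    {f : (Fin s → ℝ) → ℝ} {F : Finset (Fin s) → (Fin s → ℝ) → ℝ} (hF : F ∅ = f)
    (hFc : ∀ u, ContinuousOn (F u) (Icc 0 1))
    (hFd : ∀ u i, i ∉ u → ∀ z ∈ Icc (0 : Fin s → ℝ) 1,
      HasDerivAt (fun t => F u (update z i t)) (F (insert i u) z) (z i)) :
    |(∫ z in Icc (0 : Fin s → ℝ) 1, f z) - (∑ n, f (x n)) / N| ≤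
      starDiscrepancy x * ∑ u, ∫ z in Icc (0 : Fin s → ℝ) 1, |F u (projOne u z)| := by
  rw [abs_sub_comm]
  refine (koksma_hlawka_starDiscrepancy hN hx0 hx1 hF hFc hFd).trans ?_
  refine mul_le_mul_of_nonneg_left ?_ (starDiscrepancy_nonneg x)
  exact sum_le_sum_of_subset_of_nonneg (filter_subset _ _) fun u _ _ =>
    MeasureTheory.integral_nonneg fun z => abs_nonneg _

end Discrepancy

end Literature.NumberTheory.DiophantineApproximation
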